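import Summits.AnomalousDissipation.AnomalousDissipation.Theorems.SolenoidalFractalHomogenisationLagrangianStepVmodCoarseDecay
import Summits.AnomalousDissipation.AnomalousDissipation.Theorems.SolenoidalFractalHomogenisationLagrangianStepW7ThreeModeFibre
import Literature.Analysis.FluidPDE.PassiveVectorTensorTwoProblemDuality
import HarnessLib

/-!
# K1L_D (stmt-AnomalousDissipation-27980): (V_mod) flat stage — the DRIFT-FREE TENSOR CHANGE, modewise:
# `|⟪V x, ζ⟫ − ⟪T x, ζ⟫| ≤ 4π²·(K₁ + K₂)·(t − s)·Σ_{k∈S} |k|²‖x̂ k‖‖ζ̂ k‖`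
(line file of the (V_mod) lane, short-window engine F4b of the (ff) block (and of (fs)/(sf)); prover ad-k3l-bookkeeping-p1 g9.)

For the drift-free propagators `V`, `T` of two elliptic constant tensors `𝔹₁`, `𝔹₂` (`NearIso 𝔹ᵢ loᵢ hiᵢ`, `0 < loᵢ`, `0 ≤ hiᵢ`, `OddSmall 𝔹ᵢ βᵢ`,
`0 ≤ βᵢ`; symbol bounds `Kᵢ = hiᵢ + βᵢ/2` on transversal vectors, `ThreeMode.re_inner_symbT_le`), a weakly divergence-free datum `x ∈ V2` and a
weakly divergence-free test `ζ ∈ V2` with Fourier support in a finite set `S`, the two-problem duality of `PassiveVectorTensorTwoProblemDuality`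
(`b₁ = b₂ = 0`: no transport cross term) against the drift-free adjoint evolution `ψ` of `ζ` (which keeps the support `S` and does not increase any
mode, `norm_sq_fcoeff_carrierFree_decay`) leaves the viscous cross series `Σ_{k∈S} −4π² Re⟨v̂(σ)(k), (T_{𝔹₁}(k) − T_{𝔹₂}(k)) ψ̂(t₀−σ)(k)⟩`, bounded by
`4π²(K₁+K₂) Σ_{k∈S} |k|²‖x̂ k‖‖ζ̂ k‖`.  Result: **`abs_inner_sub_inner_tensorChange_le`**.  `sorry`-free; NOT a proof of any block, of the stub, of
K1L_D or AD; rung F-D1.A0.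
-/

set_option linter.dupNamespace false

noncomputable section

namespace Summit.AnomalousDissipation.AnomalousDissipation.Theorems.SolenoidalFractalHomogenisation.LagrangianStep.VmodFlat

open Literature.Analysis Literature.Analysis.FluidPDE Literature.Analysis.FunctionSpaces
open MeasureTheory Set Filter UnitAddTorus Complex
open scoped ENNReal NNReal InnerProductSpace
open Summit.AnomalousDissipation.AnomalousDissipation.Theorems.SolenoidalFractalHomogenisation.LagrangianStep.CellClauseMod

/-! ## §1 Modewise facts for drift-free propagators -/

/-- Along a drift-free propagator no Fourier mode grows: `‖𝓕(U s t x)(k)‖ ≤ ‖𝓕x(k)‖` (weakly divergence-free `x`). [folklore] -/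
theorem norm_fc_driftFree_le {T₀ : ℝ} {𝔹 : Torus.Visc4 (Fin 3)} {lo' hi' : ℝ} (h𝔹 : Torus.NearIso 𝔹 lo' hi') (hlo' : 0 < lo')
    {U : ℝ → ℝ → (V2 →L[ℝ] V2)}
    (hU : Torus.IsPropagator T₀ (fun (_ : ℝ) (_ : UnitAddTorus (Fin 3)) => (0 : EuclideanSpace ℝ (Fin 3))) 𝔹 U)
    {s t : ℝ} (hs : 0 ≤ s) (hst : s ≤ t) (htT : t ≤ T₀) (hsT : s < T₀) (x : V2) (hx : Torus.IsWeaklyDivFree (x : VF)) (k : Fin 3 → ℤ) :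
    ‖fc (U s t x) k‖ ≤ ‖fc x k‖ := by
  have h := norm_sq_fcoeff_carrierFree_decay h𝔹 hlo' hU hs hst htT hsT x hx k
  have hE : Real.exp (-(8 * Real.pi ^ 2 * lo' * Torus.freqNormSq k * (t - s))) ≤ 1 := by
    rw [Real.exp_le_one_iff]
    have : 0 ≤ 8 * Real.pi ^ 2 * lo' * Torus.freqNormSq k * (t - s) :=
      mul_nonneg (mul_nonneg (by positivity) (Torus.freqNormSq_nonneg k)) (by linarith)
    linarith
  have h2 : ‖fc (U s t x) k‖ ^ 2 ≤ ‖fc x k‖ ^ 2 := h.trans (by nlinarith [sq_nonneg ‖fc x k‖])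
  have := Real.sqrt_le_sqrt h2
  rwa [Real.sqrt_sq (norm_nonneg _), Real.sqrt_sq (norm_nonneg _)] at this

/-- The Fourier coefficients of (a representative of) a class in the range of a propagator are transversal. [folklore] -/
theorem kdot_fc_propagator {T₀ : ℝ} {b : ℝ → VF} {𝔹 : Torus.Visc4 (Fin 3)} {U : ℝ → ℝ → (V2 →L[ℝ] V2)} (hU : Torus.IsPropagator T₀ b 𝔹 U)
    (s t : ℝ) (x : V2) (k : Fin 3 → ℤ) : Torus.kdot k (fc (U s t x) k) = 0 := by
  rw [Torus.kdot_apply, fc]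
  exact (hU.divFree s t x).sum_mul_mFourierCoeff_eq_zero (Lp.memLp _) k

/-- `|Re⟨a, (T_{𝔹₁}(k) − T_{𝔹₂}(k)) z⟩| ≤ (K₁ + K₂)·|k|²·‖z‖·‖a‖` for transversal `a, z`, `Kᵢ = hiᵢ + βᵢ/2`. [folklore] -/
theorem abs_re_inner_symbT_sub_le {𝔹₁ 𝔹₂ : Torus.Visc4 (Fin 3)} {lo₁ hi₁ β₁ lo₂ hi₂ β₂ : ℝ} (h₁ : Torus.NearIso 𝔹₁ lo₁ hi₁) (hlo₁ : 0 ≤ lo₁)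
    (hhi₁ : 0 ≤ hi₁) (hodd₁ : Torus.OddSmall 𝔹₁ β₁) (hβ₁ : 0 ≤ β₁) (h₂ : Torus.NearIso 𝔹₂ lo₂ hi₂) (hlo₂ : 0 ≤ lo₂) (hhi₂ : 0 ≤ hi₂)
    (hodd₂ : Torus.OddSmall 𝔹₂ β₂) (hβ₂ : 0 ≤ β₂) (k : Fin 3 → ℤ) {a z : EuclideanSpace ℂ (Fin 3)} (ha : Torus.kdot k a = 0)
    (hz : Torus.kdot k z = 0) :
    |(⟪a, Torus.symbT 𝔹₁ k z - Torus.symbT 𝔹₂ k z⟫_ℂ).re| ≤ (hi₁ + β₁ / 2 + (hi₂ + β₂ / 2)) * Torus.freqNormSq k * (‖z‖ * ‖a‖) := by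
  have ha' : Torus.kdot k (-a) = 0 := by rw [map_neg, ha, neg_zero]
  have e1 := ThreeMode.re_inner_symbT_le h₁ hlo₁ hhi₁ hodd₁ hβ₁ k ha hz
  have e1' := ThreeMode.re_inner_symbT_le h₁ hlo₁ hhi₁ hodd₁ hβ₁ k ha' hz
  have e2 := ThreeMode.re_inner_symbT_le h₂ hlo₂ hhi₂ hodd₂ hβ₂ k ha hz
  have e2' := ThreeMode.re_inner_symbT_le h₂ hlo₂ hhi₂ hodd₂ hβ₂ k ha' hz
  rw [inner_neg_left, Complex.neg_re, norm_neg] at e1' e2'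
  rw [inner_sub_right, Complex.sub_re, abs_le]
  constructor <;> nlinarith [e1, e1', e2, e2']

/-! ## §2 The drift-free tensor change -/

set_option maxHeartbeats 800000 in
/-- **DRIFT-FREE TENSOR CHANGE, MODEWISE.**  Let `V`, `T` be the drift-free propagators of two elliptic constant tensors `𝔹₁`, `𝔹₂`
(`NearIso 𝔹ᵢ loᵢ hiᵢ`, `0 < loᵢ`, `0 ≤ hiᵢ`, `OddSmall 𝔹ᵢ βᵢ`, `0 ≤ βᵢ`), `x ∈ V2` weakly divergence free, `ζ ∈ V2` weakly divergence free with
Fourier support in the finite set `S`, and `0 ≤ s ≤ t ≤ T₀`.  Then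
`|⟪V s t x, ζ⟫ − ⟪T s t x, ζ⟫| ≤ 4π²·(hi₁ + β₁/2 + hi₂ + β₂/2)·(t − s)·Σ_{k∈S} |k|²·‖𝓕x(k)‖·‖𝓕ζ(k)‖`. [folklore] -/
theorem abs_inner_sub_inner_tensorChange_le {T₀ : ℝ} {𝔹₁ 𝔹₂ : Torus.Visc4 (Fin 3)} {lo₁ hi₁ β₁ lo₂ hi₂ β₂ : ℝ}
    (h𝔹₁ : Torus.NearIso 𝔹₁ lo₁ hi₁) (hlo₁ : 0 < lo₁) (hhi₁ : 0 ≤ hi₁) (hodd₁ : Torus.OddSmall 𝔹₁ β₁) (hβ₁ : 0 ≤ β₁)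
    (h𝔹₂ : Torus.NearIso 𝔹₂ lo₂ hi₂) (hlo₂ : 0 < lo₂) (hhi₂ : 0 ≤ hi₂) (hodd₂ : Torus.OddSmall 𝔹₂ β₂) (hβ₂ : 0 ≤ β₂)
    {V T : ℝ → ℝ → (V2 →L[ℝ] V2)}
    (hV : Torus.IsPropagator T₀ (fun (_ : ℝ) (_ : UnitAddTorus (Fin 3)) => (0 : EuclideanSpace ℝ (Fin 3))) 𝔹₁ V)
    (hT : Torus.IsPropagator T₀ (fun (_ : ℝ) (_ : UnitAddTorus (Fin 3)) => (0 : EuclideanSpace ℝ (Fin 3))) 𝔹₂ T)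
    {s t : ℝ} (hs : 0 ≤ s) (hst : s ≤ t) (htT : t ≤ T₀) (x ζ : V2) (hxdiv : Torus.IsWeaklyDivFree (x : VF))
    (hζdiv : Torus.IsWeaklyDivFree (ζ : VF)) (S : Finset (Fin 3 → ℤ)) (hζS : ∀ k, k ∉ S → fc ζ k = 0) :
    |⟪V s t x, ζ⟫_ℝ - ⟪T s t x, ζ⟫_ℝ| ≤
      4 * Real.pi ^ 2 * (hi₁ + β₁ / 2 + (hi₂ + β₂ / 2)) * (t - s) * ∑ k ∈ S, Torus.freqNormSq k * (‖fc x k‖ * ‖fc ζ k‖) := by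
  set Ksum : ℝ := hi₁ + β₁ / 2 + (hi₂ + β₂ / 2) with hKdef
  have hK0 : 0 ≤ Ksum := by rw [hKdef]; positivity
  set Ssum : ℝ := ∑ k ∈ S, Torus.freqNormSq k * (‖fc x k‖ * ‖fc ζ k‖) with hSdef
  have hS0 : 0 ≤ Ssum := Finset.sum_nonneg fun k _ => mul_nonneg (Torus.freqNormSq_nonneg k) (mul_nonneg (norm_nonneg _) (norm_nonneg _))
  -- the case `t = s`
  rcases hst.eq_or_lt with heq | hst'
  · subst heq
    rw [hV.self_of_divFree s hs htT x hxdiv, hT.self_of_divFree s hs htT x hxdiv, sub_self, abs_zero, sub_self]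
    simp
  have hsT : s < T₀ := hst'.trans_le htT
  set t₀ : ℝ := t - s with ht₀def
  have ht₀ : 0 < t₀ := sub_pos.2 hst'
  set L : ℝ := T₀ - s with hLdef
  have ht₀L : t₀ ≤ L := by rw [ht₀def, hLdef]; linarith
  -- a common ellipticity window
  set lo : ℝ := min lo₁ lo₂ with hlodef
  set hi : ℝ := max hi₁ hi₂ with hhidef
  have hlo : 0 < lo := lt_min hlo₁ hlo₂
  have h𝔹₁' : Torus.NearIso 𝔹₁ lo hi := h𝔹₁.mono (min_le_left _ _) (le_max_left _ _)
  have h𝔹₂' : Torus.NearIso 𝔹₂ lo hi := h𝔹₂.mono (min_le_right _ _) (le_max_right _ _)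
  -- the datum and the test as functions
  set y : VF := ((x : V2) : VF) with hydef
  have hy : MemLp y 2 volume := Lp.memLp x
  have hPy : hy.toLp y = x := Lp.toLp_coeFn x hy
  have hζm : MemLp ((ζ : V2) : VF) 2 volume := Lp.memLp ζ
  have hζLp : hζm.toLp ((ζ : V2) : VF) = ζ := Lp.toLp_coeFn ζ hζm
  -- zero carriers
  have hz : MemLp (Torus.stLift (fun (_ : ℝ) (_ : UnitAddTorus (Fin 3)) => (0 : EuclideanSpace ℝ (Fin 3)))) ∞
      (volume.restrict (Ioo (0:ℝ) L ×ˢ (univ : Set (EuclideanSpace ℝ (Fin 3))))) := memLp_top_const 0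
  have hz' : MemLp (Torus.stLift (fun (τ : ℝ) => (fun (_ : ℝ) (_ : UnitAddTorus (Fin 3)) => (0 : EuclideanSpace ℝ (Fin 3))) (s + τ))) ∞
      (volume.restrict (Ioo (0:ℝ) L ×ˢ (univ : Set (EuclideanSpace ℝ (Fin 3))))) := memLp_top_const 0
  have hbV : MemLp (Torus.stLift (fun (_ : ℝ) (_ : UnitAddTorus (Fin 3)) => (0 : EuclideanSpace ℝ (Fin 3)))) ∞
      (volume.restrict (Ioo (0:ℝ) T₀ ×ˢ (univ : Set (EuclideanSpace ℝ (Fin 3))))) := memLp_top_const 0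
  have hbVdiv : ∀ᵐ τ ∂(volume.restrict (Ioo (0:ℝ) T₀)),
      Torus.IsWeaklyDivFree ((fun (_ : ℝ) (_ : UnitAddTorus (Fin 3)) => (0 : EuclideanSpace ℝ (Fin 3))) τ) :=
    ae_of_all _ fun τ θ hθ => by simp
  have hbW : MemLp (Torus.stLift (fun (_ : ℝ) (_ : UnitAddTorus (Fin 3)) => (0 : EuclideanSpace ℝ (Fin 3)))) ∞
      (volume.restrict (Ioo (0:ℝ) t₀ ×ˢ (univ : Set (EuclideanSpace ℝ (Fin 3))))) := memLp_top_const 0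
  have hbWdiv : ∀ᵐ τ ∂(volume.restrict (Ioo (0:ℝ) t₀)),
      Torus.IsWeaklyDivFree ((fun (_ : ℝ) (_ : UnitAddTorus (Fin 3)) => (0 : EuclideanSpace ℝ (Fin 3))) τ) :=
    ae_of_all _ fun τ θ hθ => by simp
  -- window solutions from `x` for the two tensors
  have hu := Torus.windowSol_spec h𝔹₁' hlo hbV hbVdiv hs hsT hy hxdiv
  set u := Torus.windowSol h𝔹₁' hlo hbV hbVdiv hs hsT hy hxdiv with hudef
  have huT := Torus.windowSol_spec h𝔹₂' hlo hbV hbVdiv hs hsT hy hxdiv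
  set uT := Torus.windowSol h𝔹₂' hlo hbV hbVdiv hs hsT hy hxdiv with huTdef
  -- the adjoint drift-free propagator of `𝔹₂ᵀ` on the horizon `t₀`, and its window solution from `ζ`
  have h𝔹₂T : Torus.NearIso (Torus.majorTranspose 𝔹₂) lo hi := (Torus.nearIso_majorTranspose_iff 𝔹₂ lo hi).2 h𝔹₂'
  obtain ⟨W, hW⟩ := Torus.exists_isPropagator h𝔹₂T hlo hbW hbWdiv
  have hψ0 := Torus.windowSol_spec h𝔹₂T hlo hbW hbWdiv le_rfl ht₀ hζm hζdiv
  set ψ := Torus.windowSol h𝔹₂T hlo hbW hbWdiv le_rfl ht₀ hζm hζdiv with hψdef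
  have ecar : (fun r : ℝ => -((fun (_ : ℝ) (_ : UnitAddTorus (Fin 3)) => (0 : EuclideanSpace ℝ (Fin 3))) (t₀ - r))) =
      (fun τ : ℝ => (fun (_ : ℝ) (_ : UnitAddTorus (Fin 3)) => (0 : EuclideanSpace ℝ (Fin 3))) (0 + τ)) := by
    funext r yy; simp
  have key : ∀ (T' : ℝ) (car : ℝ → VF), T' = t₀ - 0 →
      car = (fun τ : ℝ => (fun (_ : ℝ) (_ : UnitAddTorus (Fin 3)) => (0 : EuclideanSpace ℝ (Fin 3))) (0 + τ)) →
      Torus.IsWeakTensorPassiveVectorOn 0 (t₀ - 0) (Torus.majorTranspose 𝔹₂)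
        (fun τ : ℝ => (fun (_ : ℝ) (_ : UnitAddTorus (Fin 3)) => (0 : EuclideanSpace ℝ (Fin 3))) (0 + τ)) ((ζ : V2) : VF) ψ →
      Torus.IsWeakTensorPassiveVectorOn 0 T' (Torus.majorTranspose 𝔹₂) car ((ζ : V2) : VF) ψ := by
    rintro _ _ rfl rfl h; exact h
  have hψ : Torus.IsWeakTensorPassiveVectorOn 0 t₀ (Torus.majorTranspose 𝔹₂)
      (fun r : ℝ => -((fun (_ : ℝ) (_ : UnitAddTorus (Fin 3)) => (0 : EuclideanSpace ℝ (Fin 3))) (t₀ - r))) ((ζ : V2) : VF) ψ :=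
    key t₀ _ (sub_zero t₀).symm ecar hψ0
  -- the common pairing `h r = ⟪W 0 r ζ, x⟫`
  set h : ℝ → ℝ := fun r => ⟪W 0 r ζ, x⟫_ℝ with hhdef
  have hhc : ContinuousOn h (Icc 0 t₀) := hW.continuousOn 0 le_rfl ht₀.le ζ x
  have hreprW := hW.repr 0 le_rfl ht₀ ((ζ : V2) : VF) hζm hζdiv ψ hψ0
  have hsub0 : Ioo (0:ℝ) t₀ ⊆ Ioo 0 (t₀ - 0) := by rw [sub_zero]
  have hh_ae : ∀ᵐ r ∂(volume.restrict (Ioo (0:ℝ) t₀)), ∫ yy, ⟪ψ r yy, y yy⟫_ℝ = h r := by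
    filter_upwards [ae_restrict_of_ae_restrict_of_subset hsub0 hreprW] with r hr
    obtain ⟨hrm, hre⟩ := hr
    rw [zero_add, hζLp] at hre
    have hae : ψ r =ᵐ[volume] ((W 0 r ζ : V2) : VF) := by rw [← hre]; exact hrm.coeFn_toLp.symm
    show ∫ yy, ⟪ψ r yy, y yy⟫_ℝ = ⟪W 0 r ζ, x⟫_ℝ
    rw [MeasureTheory.L2.inner_def]
    exact integral_congr_ae (hae.mono fun yy hyy => by simp only [hyy, hydef])
  -- ### the duality for `V` (tensors `𝔹₁` vs `𝔹₂`: viscous cross term) and for `T` (no cross term)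
  obtain ⟨G, -, hGsum, c, -, hg, hh⟩ := hu.exists_integrableOn_hasSum_cross_sub_traces ht₀ ht₀L hψ h𝔹₁' h𝔹₂' hlo hy hxdiv hζm
    hζdiv hz' hz
  obtain ⟨G', -, hG'sum, c', -, hg', hh'⟩ := huT.exists_integrableOn_hasSum_cross_sub_traces ht₀ ht₀L hψ h𝔹₂' h𝔹₂' hlo hy hxdiv hζm
    hζdiv hz' hz
  have hc : h t₀ = c := hh h hhc hh_ae
  have hc' : h t₀ = c' := hh' h hhc hh_ae
  -- `g`, `g'`: the pairings along `V`, `T`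
  have hmaps : MapsTo (fun r : ℝ => s + r) (Icc 0 L) (Icc s T₀) := by
    intro r hr; exact ⟨by linarith [hr.1], by rw [hLdef] at hr; linarith [hr.2]⟩
  set g : ℝ → ℝ := fun r => ⟪V s (s + r) x, ζ⟫_ℝ with hgdef
  have hgc : ContinuousOn g (Icc 0 L) :=
    (hV.continuousOn s hs hsT.le x ζ).comp (continuous_const.add continuous_id).continuousOn hmaps
  have hreprV := hV.repr s hs hsT y hy hxdiv u hu
  have hg_ae : ∀ᵐ r ∂(volume.restrict (Ioo (0:ℝ) L)), ∫ yy, ⟪u r yy, ((ζ : V2) : VF) yy⟫_ℝ = g r := by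
    filter_upwards [hreprV] with r hr
    obtain ⟨hrm, hre⟩ := hr
    rw [hPy] at hre
    have hae : u r =ᵐ[volume] ((V s (s + r) x : V2) : VF) := by rw [← hre]; exact hrm.coeFn_toLp.symm
    show ∫ yy, ⟪u r yy, ((ζ : V2) : VF) yy⟫_ℝ = ⟪V s (s + r) x, ζ⟫_ℝ
    rw [MeasureTheory.L2.inner_def]
    exact integral_congr_ae (hae.mono fun yy hyy => by simp only [hyy])
  have hgV : g t₀ = c + ∫ σ in Ioc 0 t₀, G σ := hg g hgc hg_ae
  set g' : ℝ → ℝ := fun r => ⟪T s (s + r) x, ζ⟫_ℝ with hg'def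
  have hg'c : ContinuousOn g' (Icc 0 L) :=
    (hT.continuousOn s hs hsT.le x ζ).comp (continuous_const.add continuous_id).continuousOn hmaps
  have hreprT := hT.repr s hs hsT y hy hxdiv uT huT
  have hg'_ae : ∀ᵐ r ∂(volume.restrict (Ioo (0:ℝ) L)), ∫ yy, ⟪uT r yy, ((ζ : V2) : VF) yy⟫_ℝ = g' r := by
    filter_upwards [hreprT] with r hr
    obtain ⟨hrm, hre⟩ := hr
    rw [hPy] at hre
    have hae : uT r =ᵐ[volume] ((T s (s + r) x : V2) : VF) := by rw [← hre]; exact hrm.coeFn_toLp.symm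
    show ∫ yy, ⟪uT r yy, ((ζ : V2) : VF) yy⟫_ℝ = ⟪T s (s + r) x, ζ⟫_ℝ
    rw [MeasureTheory.L2.inner_def]
    exact integral_congr_ae (hae.mono fun yy hyy => by simp only [hyy])
  have hgT : g' t₀ = c' + ∫ σ in Ioc 0 t₀, G' σ := hg' g' hg'c hg'_ae
  -- `G' = 0` a.e., hence `∫ G' = 0`
  have h0F : ∀ k : Fin 3 → ℤ,
      mFourierCoeff (EuclideanSpace.complexify ∘ fun _ : UnitAddTorus (Fin 3) => (0 : EuclideanSpace ℝ (Fin 3))) k = 0 := fun k => by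
    simp [mFourierCoeff]
  have hG'0 : ∀ᵐ σ ∂(volume.restrict (Ioo (0:ℝ) t₀)), G' σ = 0 := by
    filter_upwards [hG'sum] with σ hσ
    have h0 : HasSum (fun _ : Fin 3 → ℤ => (0:ℝ)) (G' σ) := by
      refine hσ.congr_fun fun k => ?_
      simp [h0F]
    exact h0.unique hasSum_zero
  have hIG' : ∫ σ in Ioc 0 t₀, G' σ = 0 := by
    rw [integral_Ioc_eq_integral_Ioo]
    exact integral_eq_zero_of_ae hG'0
  -- ### the pointwise bound `|G σ| ≤ 4π² K Ssum` for a.e. `σ ∈ (0, t₀)`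
  have hsub : Ioo (0:ℝ) t₀ ⊆ Ioo 0 L := Ioo_subset_Ioo le_rfl ht₀L
  have hreprW0 : ∀ᵐ σ ∂(volume.restrict (Ioo (0:ℝ) t₀)),
      ∃ hτ : MemLp (ψ (t₀ - σ)) 2 volume, hτ.toLp (ψ (t₀ - σ)) = W 0 (0 + (t₀ - σ)) (hζm.toLp ((ζ : V2) : VF)) := by
    have hmp : MeasurePreserving (fun r : ℝ => t₀ - r) (volume.restrict (Ioo 0 t₀)) (volume.restrict (Ioo 0 t₀)) := by
      have h1 := (Measure.measurePreserving_sub_left (volume : Measure ℝ) t₀).restrict_preimage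
        (measurableSet_Ioo (a := (0:ℝ)) (b := t₀))
      have hpre : (fun r : ℝ => t₀ - r) ⁻¹' Ioo 0 t₀ = Ioo 0 t₀ := by
        ext r; simp only [mem_preimage, mem_Ioo]; constructor <;> rintro ⟨h1, h2⟩ <;> constructor <;> linarith
      rwa [hpre] at h1
    exact hmp.quasiMeasurePreserving.ae (ae_restrict_of_ae_restrict_of_subset hsub0 hreprW)
  have hGbound : ∀ᵐ σ ∂(volume.restrict (Ioo (0:ℝ) t₀)), |G σ| ≤ 4 * Real.pi ^ 2 * Ksum * Ssum := by
    filter_upwards [hGsum, ae_restrict_of_ae_restrict_of_subset hsub hreprV, hreprW0, ae_restrict_mem measurableSet_Ioo]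
      with σ hσ hUσ hWσ hσmem
    obtain ⟨huσ2, hueq⟩ := hUσ
    obtain ⟨hψσ2, hψeq⟩ := hWσ
    rw [hPy] at hueq
    rw [zero_add, hζLp] at hψeq
    -- the modes of `u σ` and of `ψ (t₀ − σ)` are those of the orbits
    have hua : u σ =ᵐ[volume] ((V s (s + σ) x : V2) : VF) := by rw [← hueq]; exact huσ2.coeFn_toLp.symm
    have hψa : ψ (t₀ - σ) =ᵐ[volume] ((W 0 (t₀ - σ) ζ : V2) : VF) := by rw [← hψeq]; exact hψσ2.coeFn_toLp.symm
    have hfu : ∀ k, mFourierCoeff (EuclideanSpace.complexify ∘ u σ) k = fc (V s (s + σ) x) k := fun k => by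
      rw [fc]; exact Torus.mFourierCoeff_congr_ae (hua.fun_comp EuclideanSpace.complexify) k
    have hfψ : ∀ k, mFourierCoeff (EuclideanSpace.complexify ∘ ψ (t₀ - σ)) k = fc (W 0 (t₀ - σ) ζ) k := fun k => by
      rw [fc]; exact Torus.mFourierCoeff_congr_ae (hψa.fun_comp EuclideanSpace.complexify) k
    have hσ1 : 0 ≤ t₀ - σ := by linarith [hσmem.2]
    have hσ2 : t₀ - σ ≤ t₀ := by linarith [hσmem.1]
    have hnu : ∀ k, ‖fc (V s (s + σ) x) k‖ ≤ ‖fc x k‖ := fun k =>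
      norm_fc_driftFree_le h𝔹₁' hlo hV hs (by linarith [hσmem.1]) (by rw [ht₀def] at hσmem; linarith [hσmem.2]) hsT x hxdiv k
    have hnψ : ∀ k, ‖fc (W 0 (t₀ - σ) ζ) k‖ ≤ ‖fc ζ k‖ := fun k =>
      norm_fc_driftFree_le h𝔹₂T hlo hW le_rfl hσ1 hσ2 ht₀ ζ hζdiv k
    have hψS : ∀ k, k ∉ S → fc (W 0 (t₀ - σ) ζ) k = 0 := fun k hk => by
      have := hnψ k; rw [hζS k hk, norm_zero] at this
      exact norm_le_zero_iff.1 this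
    -- the summand
    set f : (Fin 3 → ℤ) → ℝ := fun k => (((-(4 * Real.pi ^ 2 : ℝ) : ℂ)) *
      ⟪fc (V s (s + σ) x) k, Torus.symbT 𝔹₁ k (fc (W 0 (t₀ - σ) ζ) k) - Torus.symbT 𝔹₂ k (fc (W 0 (t₀ - σ) ζ) k)⟫_ℂ).re with hfdef
    have hσ' : HasSum f (G σ) := by
      refine hσ.congr_fun fun k => ?_
      simp only [hfdef, hfu, hfψ, WithLp.ofLp_zero, Pi.zero_apply, sub_self, zero_smul]
      simp [h0F]
    have hfS : ∀ k, k ∉ S → f k = 0 := fun k hk => by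
      simp only [hfdef]
      rw [hψS k hk, Torus.symbT_zero, Torus.symbT_zero, sub_self, inner_zero_right, mul_zero, Complex.zero_re]
    have hGσ : G σ = ∑ k ∈ S, f k := hσ'.unique (hasSum_sum_of_ne_finset_zero hfS)
    rw [hGσ]
    refine (Finset.abs_sum_le_sum_abs _ _).trans ?_
    rw [hSdef, Finset.mul_sum]
    refine Finset.sum_le_sum fun k _ => ?_
    have ha : Torus.kdot k (fc (V s (s + σ) x) k) = 0 := kdot_fc_propagator hV s (s + σ) x k
    have hzk : Torus.kdot k (fc (W 0 (t₀ - σ) ζ) k) = 0 := kdot_fc_propagator hW 0 (t₀ - σ) ζ k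
    have hin := abs_re_inner_symbT_sub_le h𝔹₁ hlo₁.le hhi₁ hodd₁ hβ₁ h𝔹₂ hlo₂.le hhi₂ hodd₂ hβ₂ k ha hzk
    have e1 : |f k| = 4 * Real.pi ^ 2 *
        |(⟪fc (V s (s + σ) x) k, Torus.symbT 𝔹₁ k (fc (W 0 (t₀ - σ) ζ) k) - Torus.symbT 𝔹₂ k (fc (W 0 (t₀ - σ) ζ) k)⟫_ℂ).re| := by
      rw [hfdef]; dsimp only
      rw [← Complex.ofReal_neg, Complex.re_ofReal_mul, abs_mul, abs_neg, abs_of_pos (by positivity : (0:ℝ) < 4 * Real.pi ^ 2)]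
    rw [e1]
    have h4 : (0:ℝ) ≤ 4 * Real.pi ^ 2 := by positivity
    calc 4 * Real.pi ^ 2 * |(⟪fc (V s (s + σ) x) k,
            Torus.symbT 𝔹₁ k (fc (W 0 (t₀ - σ) ζ) k) - Torus.symbT 𝔹₂ k (fc (W 0 (t₀ - σ) ζ) k)⟫_ℂ).re|
        ≤ 4 * Real.pi ^ 2 * (Ksum * Torus.freqNormSq k * (‖fc (W 0 (t₀ - σ) ζ) k‖ * ‖fc (V s (s + σ) x) k‖)) :=
          mul_le_mul_of_nonneg_left hin h4
      _ ≤ 4 * Real.pi ^ 2 * (Ksum * Torus.freqNormSq k * (‖fc ζ k‖ * ‖fc x k‖)) := by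
          gcongr
          · exact mul_nonneg hK0 (Torus.freqNormSq_nonneg k)
          · exact hnψ k
          · exact hnu k
      _ = 4 * Real.pi ^ 2 * Ksum * (Torus.freqNormSq k * (‖fc x k‖ * ‖fc ζ k‖)) := by ring
  -- ### assembling
  have hC0 : 0 ≤ 4 * Real.pi ^ 2 * Ksum * Ssum := by positivity
  have hInt : |∫ σ in Ioc 0 t₀, G σ| ≤ 4 * Real.pi ^ 2 * Ksum * Ssum * t₀ := by
    rw [integral_Ioc_eq_integral_Ioo]
    have h1 := norm_setIntegral_le_of_norm_le_const_ae (μ := (volume : Measure ℝ)) (s := Ioo (0:ℝ) t₀) (f := G)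
      (C := 4 * Real.pi ^ 2 * Ksum * Ssum) measure_Ioo_lt_top (hGbound.mono fun σ hσ => by rw [Real.norm_eq_abs]; exact hσ)
    rw [Real.norm_eq_abs, Real.volume_real_Ioo_of_le ht₀.le, sub_zero] at h1
    exact h1
  have hst₀ : s + t₀ = t := by rw [ht₀def]; ring
  have hgt : g t₀ = ⟪V s t x, ζ⟫_ℝ := by rw [hgdef]; simp only [hst₀]
  have hg't : g' t₀ = ⟪T s t x, ζ⟫_ℝ := by rw [hg'def]; simp only [hst₀]
  have hdiff : ⟪V s t x, ζ⟫_ℝ - ⟪T s t x, ζ⟫_ℝ = ∫ σ in Ioc 0 t₀, G σ := by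
    rw [← hgt, ← hg't, hgV, hgT, hIG', ← hc, ← hc']; ring
  rw [hdiff]
  calc |∫ σ in Ioc 0 t₀, G σ| ≤ 4 * Real.pi ^ 2 * Ksum * Ssum * t₀ := hInt
    _ = 4 * Real.pi ^ 2 * Ksum * t₀ * Ssum := by ring

end Summit.AnomalousDissipation.AnomalousDissipation.Theorems.SolenoidalFractalHomogenisation.LagrangianStep.VmodFlat

end
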